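import Literature.MathematicalPhysics.QuantumFieldTheory.Balaban1983to89.B9RWSums346MixedPairDir

/-!
# `Balaban1983to89.B9RWSums346MixedFactorFromLegs` — T. Bałaban, *Propagators for lattice gauge theories in a background field*, Commun. Math. Phys. **99**
# (1985) 389–434 [Balaban1985BackgroundPropagators] (3.46) p. 398 with (3.88)–(3.89) p. 409 and [4] (2.39)–(2.44) pp. 229–230, (2.52)–(2.55) p. 232, Lemma 2.1
# (2.61) p. 234: THE THIRD-ORDER MIXED FACTOR `K(h_□)G′_□h_□∇*_{U,μ}` OF ROWS 18 IN BLOCK-`L²` — the schema `B9Thm37KLetterDir.FactorsL2Mixed37Dir`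
# DERIVED (not posited) from `L²` bounds of the direction letters `P_{□,ν}`, `C_□` and two letter-free `L²` legs of the local propagator `G′_□`

statement-level skeleton of published theorems with citation tags; proofs where landed; nothing here is a claim about the Yang–Mills mass gap

THE PRINT.  (3.46) p. 398: *«‖hG′(U)λ‖, ‖h∇_UG′(U)λ‖, ‖hG′(U)∇\*_Uλ‖, ‖hΔ_UG′(U)λ‖, … ≦ B₀[(Lʲη)², Lʲη, Lʲη, 1, 1, 1]|h|e^{−δ₀d(y,y′)}‖λ‖»*;
(3.88)–(3.89) p. 409: *«Δ′_aG′₀ = I − Σ_□K(h_□)G′_□h_□ = I − R′ … The operator K(h_□)G_□h_□ satisfies the inequality (3.89), hence it is small»*, with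
`K(h_□) = Σ_μ P_{□,μ}∇_{U,μ} + C_□` ([4] (2.39)–(2.40)) and the coefficient sizes `|∂h_□| ≦ O(1)(MLʲη)⁻¹`, `|Δh_□| ≦ O(1)(MLʲη)⁻²` ([4] (2.41)–(2.44)).

WHY THIS FILE (cell `pub-ymgap`, Track A node N06 [B9], rows 18; width seat `pub-ymgap-dag-n06-w7`, g1, 2026-08-28).  The N06 certificate of record (dag-n06-d,
editions 32–36 `…N06AtOpsYNuOfRecordV6EPair*`) DISPLAYS, inside its rows-18 binder `h36H`, the third-order schema `FactorsL2Mixed37Dir (𝔬 x) (𝔡 x) (𝔩 x) 1 (H x)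
pM.θM p.δ₀ U` — the `L²` block bound of the terms `K(h_□)G′_□h_□∇\*_{U,μ}` that the mixed member `∇_{U,ν}G′∇\*_{U,μ}` of (3.46) needs after the split (3.88)
(`B9RWSums346MixedPairDir.l2mixed_of_local37_dir`, hypothesis `hFL`).  Unlike the second-order factor (dag-n06-w1's left Neumann series
`B9RWSums346SecondDiffGpLeft`, which avoids it), the mixed factor cannot be bypassed — a derivative sits on each side of `G′` in every resummation — and
it has no sup-norm source (the mixed entry `∇G′_□∇\*` is not among the four (3.42) entries).  It IS, however, a consequence of LETTER-LEVEL data plus two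
`L²` legs of the PINNED objects `G′_□ = 𝔬.Gsq`, `h_□ = 𝔬.h`, `∇_{U,ν} = 𝔡.Dd`, `∇\*_{U,μ} = 𝔡.Dsd` only, and that is what this file proves:
* §1 `L²` block-bound bookkeeping: sums (`blockBd_finsetSum`) and ★ `blockBd_comp_prefactor` — the composition `S ∘ P` of an `L²` block bound with an
  OUTPUT-BLOCK PREFACTOR `a(y)·e^{−δ_L d(y,z)}` (a letter) after an `L²` block bound `C·(L^{j_z}η)^q·e^{−δ₁d(z,y′)}` (a leg), giving
  `a(y)·C·L₀^{|q|}·c₁(d₁,δ₁,α₁)·(L^{j_y}η)^q·e^{−ρ′d(y,y′)}` for `αδ + ρ′ ≦ δ_L`, `0 ≦ ρ′ ≦ (1 − α₁)δ₁` — `B11SectG.hasMaj_comp` between the block-`L²` norms,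
  p. 398's scale transfer (`B9RWSums346Schur.scaleTransfer_len_rpow` under `Facts347`) and [4] (2.61) (`B9RWSums343Holder.conv_exp_le_of_261`); the
  q-free sibling of `B9RWSums346SecondDiff.comp_l2_transfer` that KEEPS the letter's indicator and scale prefactor on the output block.
* §2 the algebra `kopDir_Gsq_mulOp_comp_Dsd_eq`: `(K(h_□)·G′_□·M_{h_□}) ∘ ∇\*_μ = Σ_ν P_{□,ν} ∘ (∇_ν ∘ (G′_□M_{h_□}) ∘ ∇\*_μ) + C_□ ∘ ((G′_□M_{h_□}) ∘ ∇\*_μ)`,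
  and ★★ `factorsL2Mixed37Dir_of_letterL2_legs`: from (a) the letter `L²` block bounds `‖1_{Δ(y)}P_{□,ν}f‖ ≦ 1_{S′_□}(y)·θ_P·(L^{j_y}η)⁻¹·e^{−δ_L d}‖1_{Δ(y′)}f‖`,
  `‖1_{Δ(y)}C_□f‖ ≦ 1_{S′_□}(y)·θ_C·(L^{j_y}η)⁻²·e^{−δ_L d}‖1_{Δ(y′)}f‖` (printed sizes of [4] (2.41)–(2.44) read in `L²`), (b) the UNCUT MIXED LEG
  `‖1_{Δ(y)}∇_νG′_□M_{h_□}∇\*_μλ‖ ≦ B_M·e^{−δ₁d}‖λ‖` and the FIRST-ORDER LEG `‖1_{Δ(y)}G′_□M_{h_□}∇\*_μλ‖ ≦ B₁·(L^{j_y}η)·e^{−δ₁d}‖λ‖` ((3.46)₅ and (3.46)₃ for the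
  cube operator), the schema `FactorsL2Mixed37Dir 𝔬 𝔡 𝔩 R H θM ρ′ U` with `θM = (|Dir|·θ_P·B_M + θ_C·B₁·L₀)·c₁(d₁,δ₁,α₁)`.
NET FOR THE KNIT (the certificate owner's call): the displayed conjunct `FactorsL2Mixed37Dir …` becomes a `have` from two LETTER bounds and two LEGS; the legs are
statements about pinned objects only (inhabitable at the record's coordinate models from dag-n06-w1's cube estimates `B9Thm31SiteGsqGradDecayReg335Y`), the
letter bounds follow from the displayed `Identities₂.hP ∕ hPt ∕ hC ∕ hCt` majorants, `StaticOK`'s kernel rows∕columns and the two letter transposes by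
`B9RWSums346Schur.blockBd_schur` (the Schur step is NOT typed here).

HONEST SCOPE.  Finite-dimensional `L²` majorant bookkeeping over landed modules; the letter bounds, the legs, `Facts347`, `Ineq261` are HYPOTHESES where used;
nothing of [B9] asserted beyond kernel-checked parents; COUNT-NEUTRAL; N06 NOT discharged; one finite lattice at a time — nothing continuum ∕ OS ∕ mass gap ∕ Clay.
NEW file; nothing landed is modified; net new unproved facts: 0; 0 `def`.
-/

namespace Literature.MathematicalPhysics.QuantumFieldTheory.Balaban1983to89.B9RWSums346MixedFactorFromLegs

open Literature.MathematicalPhysics.QuantumFieldTheory.Balaban1983to89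
open Finset B6RandomWalk B6RandomWalkHom B9Thm37Sum B9Thm34Ext B9Thm37Glue B9Thm37Whole
open B9RWSums343to347Whole B9RWSums346Schur B9RWSums343Holder B11SectG B9SectDL2Decay B9RWSums346SecondDiffGp
open B9Thm37WholeDir B9Thm37KLetterDir B9Ineq347

noncomputable section

/-! ## §1 Block-`L²` bookkeeping: finite sums, and the composition keeping an output-block prefactor -/

section Bookkeeping

variable {g : B9.Geometry} [Fintype g.Site] {R : ℝ} {H : Prop} {X Y Z : Type} [Fintype X] [Fintype Y] [Fintype Z]

/-- `L²` block bounds add. [folklore] -/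
private theorem blockBd_add_kernels (blk₁ : X → g.Site) (blk₂ : Z → g.Site) {T₁ T₂ : (X → ℝ) →ₗ[ℝ] (Z → ℝ)}
    {K₁ K₂ : g.Site → g.Site → ℝ} (h₁ : BlockBd (g := toB6 g R H) blk₁ blk₂ T₁ K₁) (h₂ : BlockBd (g := toB6 g R H) blk₁ blk₂ T₂ K₂) :
    BlockBd (g := toB6 g R H) blk₁ blk₂ (T₁ + T₂) (fun a b => K₁ a b + K₂ a b) := by
  rw [blockBd_iff_hasMaj] at h₁ h₂ ⊢
  exact h₁.add h₂

/-- the zero operator has the zero `L²` block bound. [folklore] -/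
private theorem blockBd_zero_kernel (blk₁ : X → g.Site) (blk₂ : Z → g.Site) :
    BlockBd (g := toB6 g R H) blk₁ blk₂ (0 : (X → ℝ) →ₗ[ℝ] (Z → ℝ)) (fun _ _ => 0) := by
  rw [blockBd_iff_hasMaj]
  exact hasMaj_zero _ _

/-- `L²` block bounds of a finite sum of operators: the kernels add. [cite: Balaban1984PropagatorsII, (2.52)–(2.55) p.232, bookkeeping] -/
theorem blockBd_finsetSum {κ' : Type} (s : Finset κ') (blk₁ : X → g.Site) (blk₂ : Z → g.Site) (T : κ' → (X → ℝ) →ₗ[ℝ] (Z → ℝ))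
    (K : κ' → g.Site → g.Site → ℝ) (h : ∀ k ∈ s, BlockBd (g := toB6 g R H) blk₁ blk₂ (T k) (K k)) :
    BlockBd (g := toB6 g R H) blk₁ blk₂ (∑ k ∈ s, T k) (fun a b => ∑ k ∈ s, K k a b) := by
  classical
  induction s using Finset.induction_on with
  | empty =>
      simpa only [Finset.sum_empty] using blockBd_zero_kernel (R := R) (H := H) blk₁ blk₂
  | insert k s hk ih =>
      have hk' := h k (Finset.mem_insert_self k s)
      have hs' := ih fun j hj => h j (Finset.mem_insert_of_mem hj)
      have hadd := blockBd_add_kernels (R := R) (H := H) blk₁ blk₂ hk' hs'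
      rw [Finset.sum_insert hk]
      exact hadd.mono fun a b => by rw [Finset.sum_insert hk]

/-- ★ **COMPOSITION KEEPING AN OUTPUT-BLOCK PREFACTOR** (the letter-after-leg step of (3.88)–(3.89) in block-`L²` norms): `S` with the `L²` block bound
`a(y)·e^{−δ_L d(y,z)}` (`a ≧ 0` arbitrary — an indicator times a scale power, say) after `P` with the `L²` block bound `C·(L^{j_z}η)^q·e^{−δ₁d(z,y′)}` has the `L²`
block bound `a(y)·(C·L₀^{|q|}·c₁(d₁,δ₁,α₁))·(L^{j_y}η)^q·e^{−ρ′d(y,y′)}` whenever `αδ + ρ′ ≦ δ_L`, `0 ≦ ρ′ ≦ (1 − α₁)δ₁`, `|q| ≦ 4`: insert the block partition of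
the intermediate space ([4] (2.52)–(2.55)), move the scale power from `z` to `y` at the cost `e^{αδd(y,z)}·L^{|q|}` (p. 398), and sum the row by (2.61).
[cite: Balaban1985BackgroundPropagators, (3.46) p.398 + remark after (3.47) p.398 + (3.89) p.409; Balaban1984PropagatorsII, (2.52)–(2.55) p.232 + Lemma 2.1 (2.61) p.234] -/
theorem blockBd_comp_prefactor (blk : X → g.Site) (blkY : Y → g.Site) (blkZ : Z → g.Site) {S : (X → ℝ) →ₗ[ℝ] (Z → ℝ)}
    {P : (Y → ℝ) →ₗ[ℝ] (X → ℝ)} {d d₁ : ℕ} {δ α L₀ δ₁ α₁ C ρ' δL q : ℝ} (a : g.Site → ℝ) (ha : ∀ y, 0 ≤ a y)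
    (hF : Facts347 g R H d δ α L₀) (h261 : Ineq261 d₁ (toB6 g R H) δ₁ α₁) (htri : Triangle254 (toB6 g R H))
    (hsymm : ∀ y y' : g.Site, g.dist y y' = g.dist y' y) (hdnn : ∀ y y' : g.Site, 0 ≤ g.dist y y')
    (hlen : ∀ y : g.Site, 0 < g.len y) (hC : 0 ≤ C) (hρ' : 0 ≤ ρ') (hrate : ρ' ≤ (1 - α₁) * δ₁) (hδL : α * δ + ρ' ≤ δL) (hq : |q| ≤ 4)
    (hS : BlockBd (g := toB6 g R H) blk blkZ S (fun (y z : g.Site) => a y * Real.exp (-(δL * g.dist y z))))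
    (hP : BlockBd (g := toB6 g R H) blkY blk P (fun (z b : g.Site) => C * g.len z ^ q * Real.exp (-(δ₁ * g.dist z b)))) :
    BlockBd (g := toB6 g R H) blkY blkZ (S ∘ₗ P)
      (fun (y b : g.Site) => a y * (C * L₀ ^ |q| * B6.c1 d₁ δ₁ α₁) * g.len y ^ q * Real.exp (-(ρ' * g.dist y b))) := by
  have hlen0 : ∀ y : g.Site, 0 ≤ g.len y := fun y => (hlen y).le
  have hL1 : 1 ≤ g.L := hF.one_le_L
  have hL0 : 0 ≤ g.L := zero_le_one.trans hL1
  have hL₀ : 0 ≤ L₀ := hL0.trans hF.L_le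
  have hK : ∀ y z : g.Site, 0 ≤ a y * Real.exp (-(δL * g.dist y z)) := fun y z => mul_nonneg (ha y) (Real.exp_nonneg _)
  have hS' := (blockBd_iff_hasMaj (g := toB6 g R H) blk blkZ S _).mp hS
  have hP' := (blockBd_iff_hasMaj (g := toB6 g R H) blkY blk P _).mp hP
  have hcomp := hasMaj_comp hS' hP' hK
  rw [blockBd_iff_hasMaj]
  refine hcomp.mono fun y b => ?_
  rw [l2w_κ]
  -- the letter's rate splits off the transfer margin: e^{−δ_L d} ≤ e^{−αδ d}·e^{−ρ′ d}
  have hsplit : ∀ z : g.Site, Real.exp (-(δL * g.dist y z)) ≤ Real.exp (-(α * δ * g.dist y z)) * Real.exp (-(ρ' * g.dist y z)) := by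
    intro z
    rw [← Real.exp_add]
    exact Real.exp_le_exp.mpr (by nlinarith [hdnn y z, hδL])
  -- the scale transfer (p. 398): e^{−αδ d(y,z)}·(L^{j_z}η)^q ≤ L^{|q|}·(L^{j_y}η)^q ≤ L₀^{|q|}·(L^{j_y}η)^q
  have htransfer : ∀ z : g.Site, Real.exp (-(α * δ * g.dist y z)) * g.len z ^ q ≤ L₀ ^ |q| * g.len y ^ q := by
    intro z
    have hst : Real.exp (-(α * δ * g.dist y z)) * g.len z ^ q ≤ g.L ^ |q| * g.len y ^ q := scaleTransfer_len_rpow hF q hq y z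
    exact hst.trans (mul_le_mul_of_nonneg_right (Real.rpow_le_rpow hL0 hF.L_le (abs_nonneg q)) (Real.rpow_nonneg (hlen0 y) _))
  -- the convolution at (δ₁, α₁)
  have hconv : ∑ z : g.Site, Real.exp (-(ρ' * g.dist y z)) * Real.exp (-(δ₁ * g.dist z b)) ≤ B6.c1 d₁ δ₁ α₁ * Real.exp (-(ρ' * g.dist y b)) := by
    have h := conv_exp_le_of_261 (R := R) (H := H) d₁ δ₁ α₁ ρ' hρ' hrate htri hdnn h261 b y
    have hrw : ∀ z : g.Site, Real.exp (-(ρ' * g.dist y z)) * Real.exp (-(δ₁ * g.dist z b)) =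
        Real.exp (-(δ₁ * g.dist b z)) * Real.exp (-(ρ' * g.dist z y)) := by
      intro z; rw [hsymm y z, hsymm z b, mul_comm]
    rw [Finset.sum_congr rfl fun z _ => hrw z, hsymm y b]
    exact h
  have hL₀q : 0 ≤ L₀ ^ |q| := Real.rpow_nonneg hL₀ _
  have hterm : ∀ z : g.Site, a y * Real.exp (-(δL * (toB6 g R H).dist y z)) * (1 * (C * g.len z ^ q * Real.exp (-(δ₁ * (toB6 g R H).dist z b)))) ≤
      a y * (C * L₀ ^ |q|) * g.len y ^ q * (Real.exp (-(ρ' * g.dist y z)) * Real.exp (-(δ₁ * g.dist z b))) := by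
    intro z
    simp only [toB6_dist, one_mul]
    have h1 : Real.exp (-(δL * g.dist y z)) * g.len z ^ q ≤ L₀ ^ |q| * g.len y ^ q * Real.exp (-(ρ' * g.dist y z)) := by
      calc Real.exp (-(δL * g.dist y z)) * g.len z ^ q
          ≤ (Real.exp (-(α * δ * g.dist y z)) * Real.exp (-(ρ' * g.dist y z))) * g.len z ^ q :=
            mul_le_mul_of_nonneg_right (hsplit z) (Real.rpow_nonneg (hlen0 z) _)
        _ = (Real.exp (-(α * δ * g.dist y z)) * g.len z ^ q) * Real.exp (-(ρ' * g.dist y z)) := by ring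
        _ ≤ (L₀ ^ |q| * g.len y ^ q) * Real.exp (-(ρ' * g.dist y z)) := mul_le_mul_of_nonneg_right (htransfer z) (Real.exp_nonneg _)
    have h2 := mul_le_mul_of_nonneg_left h1 (mul_nonneg (mul_nonneg (ha y) hC) (Real.exp_nonneg (-(δ₁ * g.dist z b))))
    calc a y * Real.exp (-(δL * g.dist y z)) * (C * g.len z ^ q * Real.exp (-(δ₁ * g.dist z b)))
        = a y * C * Real.exp (-(δ₁ * g.dist z b)) * (Real.exp (-(δL * g.dist y z)) * g.len z ^ q) := by ring
      _ ≤ a y * C * Real.exp (-(δ₁ * g.dist z b)) * (L₀ ^ |q| * g.len y ^ q * Real.exp (-(ρ' * g.dist y z))) := h2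
      _ = a y * (C * L₀ ^ |q|) * g.len y ^ q * (Real.exp (-(ρ' * g.dist y z)) * Real.exp (-(δ₁ * g.dist z b))) := by ring
  have hpre : 0 ≤ a y * (C * L₀ ^ |q|) * g.len y ^ q := mul_nonneg (mul_nonneg (ha y) (mul_nonneg hC hL₀q)) (Real.rpow_nonneg (hlen0 y) _)
  calc ∑ z : g.Site, a y * Real.exp (-(δL * (toB6 g R H).dist y z)) * (1 * (C * g.len z ^ q * Real.exp (-(δ₁ * (toB6 g R H).dist z b))))
      ≤ ∑ z : g.Site, a y * (C * L₀ ^ |q|) * g.len y ^ q * (Real.exp (-(ρ' * g.dist y z)) * Real.exp (-(δ₁ * g.dist z b))) :=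
        Finset.sum_le_sum fun z _ => hterm z
    _ = a y * (C * L₀ ^ |q|) * g.len y ^ q * ∑ z : g.Site, Real.exp (-(ρ' * g.dist y z)) * Real.exp (-(δ₁ * g.dist z b)) := by
        rw [Finset.mul_sum]
    _ ≤ a y * (C * L₀ ^ |q|) * g.len y ^ q * (B6.c1 d₁ δ₁ α₁ * Real.exp (-(ρ' * g.dist y b))) := mul_le_mul_of_nonneg_left hconv hpre
    _ = a y * (C * L₀ ^ |q| * B6.c1 d₁ δ₁ α₁) * g.len y ^ q * Real.exp (-(ρ' * (toB6 g R H).dist y b)) := by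
        simp only [toB6_dist]; ring

end Bookkeeping

/-! ## §2 The mixed factor `K(h_□)G′_□h_□∇*_{U,μ}` from letter bounds and legs -/

section MixedFactor

variable {g : B9.Geometry} [Fintype g.Site] [DecidableEq g.Site] {R : ℝ} {H : Prop} {B : B9.Backgrounds}
variable {X Y ι Dir : Type} [Fintype ι] [Fintype Dir]

omit [Fintype g.Site] [DecidableEq g.Site] [Fintype ι] in
/-- **THE ALGEBRA OF THE FACTOR**: `(K(h_□)·G′_□·M_{h_□}) ∘ ∇\*_μ = Σ_ν P_{□,ν} ∘ (∇_ν ∘ ((G′_□·M_{h_□}) ∘ ∇\*_μ)) + C_□ ∘ ((G′_□·M_{h_□}) ∘ ∇\*_μ)` with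
`K(h_□) = Σ_ν P_{□,ν}∇_{U,ν} + C_□` (`KopDir`). [cite: Balaban1985BackgroundPropagators, (3.88) p.409; Balaban1984PropagatorsII, (2.39)–(2.40) pp.229–230] -/
theorem kopDir_Gsq_mulOp_comp_Dsd_eq (𝔬 : Ops g B X Y ι) (𝔡 : DirOps37 𝔬 Dir) (𝔩 : DirLetters37 𝔬 Dir) (U : B.Cfg) (i : ι) (μ : Dir) :
    (KopDir 𝔬 𝔡 𝔩 U i * 𝔬.Gsq U i * mulOp (𝔬.h i)) ∘ₗ 𝔡.Dsd U μ =
      (∑ ν, 𝔩.P U i ν ∘ₗ (𝔡.Dd U ν ∘ₗ ((𝔬.Gsq U i * mulOp (𝔬.h i)) ∘ₗ 𝔡.Dsd U μ))) +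
        𝔬.Cop U i ∘ₗ ((𝔬.Gsq U i * mulOp (𝔬.h i)) ∘ₗ 𝔡.Dsd U μ) := by
  apply LinearMap.ext
  intro f
  simp only [KopDir, LinearMap.comp_apply, LinearMap.add_apply, LinearMap.sum_apply, Module.End.mul_apply]

/-- ★★ **ROWS 18's THIRD-ORDER MIXED FACTOR SCHEMA DERIVED**: if the direction letters `P_{□,ν}` and `C_□` have the `L²` block bounds
`1_{S′_□}(y)·θ_P·(L^{j_y}η)⁻¹·e^{−δ_L d(y,y′)}` and `1_{S′_□}(y)·θ_C·(L^{j_y}η)⁻²·e^{−δ_L d(y,y′)}` (the printed coefficient sizes `|∂h_□| ≦ O(1)(MLʲη)⁻¹`,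
`|Δh_□| ≦ O(1)(MLʲη)⁻²` of [4] (2.41)–(2.44) read in `L²`; `θ_P, θ_C = O(M⁻¹)`), and the cube operator has the two `L²` legs of (3.46) — the UNCUT MIXED LEG
`‖1_{Δ(y)}∇_{U,ν}G′_□M_{h_□}∇\*_{U,μ}λ‖ ≦ B_M·e^{−δ₁d(y,y′)}‖λ‖` and the FIRST-ORDER LEG `‖1_{Δ(y)}G′_□M_{h_□}∇\*_{U,μ}λ‖ ≦ B₁·(L^{j_y}η)·e^{−δ₁d(y,y′)}‖λ‖` for
`supp λ ⊂ Δ(y′)` — then the terms `K(h_□)G′_□h_□∇\*_{U,μ}` of `R′∇\*_{U,μ}` obey `FactorsL2Mixed37Dir` with `θM = (|Dir|·θ_P·B_M + θ_C·B₁·L₀)·c₁(d₁,δ₁,α₁)` at the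
rate `ρ′`, for `αδ + ρ′ ≦ δ_L` and `0 ≦ ρ′ ≦ (1 − α₁)δ₁` (§1's composition per summand, summed over `ν` and the `C_□` term).
[cite: Balaban1985BackgroundPropagators, (3.88)–(3.89) p.409 + (3.46) p.398 + remark after (3.47) p.398; Balaban1984PropagatorsII, (2.39)–(2.44) pp.229–230 + (2.52)–(2.55) p.232 + Lemma 2.1 (2.61) p.234] -/
theorem factorsL2Mixed37Dir_of_letterL2_legs [Fintype X] [Fintype Y] (𝔬 : Ops g B X Y ι) (𝔡 : DirOps37 𝔬 Dir) (𝔩 : DirLetters37 𝔬 Dir)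
    (R : ℝ) (H : Prop) (d d₁ : ℕ) (δ α L₀ δ₁ α₁ ρ N N' Cℓ δL ρ' θP θC BM B1 : ℝ) (κ : Sizes) (U : B.Cfg)
    (hθP : 0 ≤ θP) (hθC : 0 ≤ θC) (hBM : 0 ≤ BM) (hB1 : 0 ≤ B1) (hρ' : 0 ≤ ρ') (hrate : ρ' ≤ (1 - α₁) * δ₁) (hδL : α * δ + ρ' ≤ δL)
    (hs : StaticOK 𝔬 ρ N N' Cℓ κ) (h261 : Ineq261 d₁ (toB6 g R H) δ₁ α₁) (hF : Facts347 g R H d δ α L₀)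
    (hPL2 : ∀ (i : ι) (ν : Dir), BlockBd (g := toB6 g R H) 𝔬.blk 𝔬.blk (𝔩.P U i ν)
      (fun (y y' : g.Site) => (if y ∈ 𝔬.S' i then (1 : ℝ) else 0) * (θP * g.len y ^ (-1 : ℝ)) * Real.exp (-(δL * g.dist y y'))))
    (hCL2 : ∀ i : ι, BlockBd (g := toB6 g R H) 𝔬.blk 𝔬.blk (𝔬.Cop U i)
      (fun (y y' : g.Site) => (if y ∈ 𝔬.S' i then (1 : ℝ) else 0) * (θC * g.len y ^ (-2 : ℝ)) * Real.exp (-(δL * g.dist y y'))))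
    (hMix : ∀ (i : ι) (ν μ : Dir), BlockBd (g := toB6 g R H) 𝔬.blk 𝔬.blk (𝔡.Dd U ν ∘ₗ ((𝔬.Gsq U i * mulOp (𝔬.h i)) ∘ₗ 𝔡.Dsd U μ))
      (fun (y y' : g.Site) => BM * Real.exp (-(δ₁ * g.dist y y'))))
    (hOne : ∀ (i : ι) (μ : Dir), BlockBd (g := toB6 g R H) 𝔬.blk 𝔬.blk ((𝔬.Gsq U i * mulOp (𝔬.h i)) ∘ₗ 𝔡.Dsd U μ)
      (fun (y y' : g.Site) => B1 * g.len y ^ (1 : ℝ) * Real.exp (-(δ₁ * g.dist y y')))) :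
    FactorsL2Mixed37Dir 𝔬 𝔡 𝔩 R H (((Fintype.card Dir : ℝ) * (θP * BM) + θC * (B1 * L₀)) * B6.c1 d₁ δ₁ α₁) ρ' U := by
  classical
  have hlen0 : ∀ y : g.Site, 0 ≤ g.len y := fun y => (hs.lenpos y).le
  have htri : Triangle254 (toB6 g R H) := fun a b c => hs.tri a b c
  have hc1 : 0 ≤ B6.c1 d₁ δ₁ α₁ := c1_nonneg d₁ δ₁ α₁
  have hL₀ : 0 ≤ L₀ := le_trans (le_trans zero_le_one hF.one_le_L) hF.L_le
  have hind : ∀ (i : ι) (y : g.Site), 0 ≤ (if y ∈ 𝔬.S' i then (1 : ℝ) else 0) := fun i y => by split_ifs <;> norm_num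
  refine ⟨fun i μ => ?_⟩
  -- the P-terms: letter (prefactor 1_{S′}·θ_P·len⁻¹) after the uncut mixed leg (q = 0)
  have hPterm : ∀ ν : Dir, BlockBd (g := toB6 g R H) 𝔬.blk 𝔬.blk (𝔩.P U i ν ∘ₗ (𝔡.Dd U ν ∘ₗ ((𝔬.Gsq U i * mulOp (𝔬.h i)) ∘ₗ 𝔡.Dsd U μ)))
      (fun (y b : g.Site) => ((if y ∈ 𝔬.S' i then (1 : ℝ) else 0) * (θP * g.len y ^ (-1 : ℝ))) * (BM * L₀ ^ |(0 : ℝ)| * B6.c1 d₁ δ₁ α₁) *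
        g.len y ^ (0 : ℝ) * Real.exp (-(ρ' * g.dist y b))) := by
    intro ν
    have hleg : BlockBd (g := toB6 g R H) 𝔬.blk 𝔬.blk (𝔡.Dd U ν ∘ₗ ((𝔬.Gsq U i * mulOp (𝔬.h i)) ∘ₗ 𝔡.Dsd U μ))
        (fun (z b : g.Site) => BM * g.len z ^ (0 : ℝ) * Real.exp (-(δ₁ * g.dist z b))) :=
      (hMix i ν μ).mono fun z b => by rw [Real.rpow_zero, mul_one]
    exact blockBd_comp_prefactor (R := R) (H := H) 𝔬.blk 𝔬.blk 𝔬.blk (fun y => (if y ∈ 𝔬.S' i then (1 : ℝ) else 0) * (θP * g.len y ^ (-1 : ℝ)))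
      (fun y => mul_nonneg (hind i y) (mul_nonneg hθP (Real.rpow_nonneg (hlen0 y) _))) hF h261 htri hs.symm hs.dnn hs.lenpos hBM hρ' hrate hδL
      (by rw [abs_zero]; norm_num) (hPL2 i ν) hleg
  -- the C-term: letter (prefactor 1_{S′}·θ_C·len⁻²) after the first-order leg (q = 1)
  have hCterm : BlockBd (g := toB6 g R H) 𝔬.blk 𝔬.blk (𝔬.Cop U i ∘ₗ ((𝔬.Gsq U i * mulOp (𝔬.h i)) ∘ₗ 𝔡.Dsd U μ))
      (fun (y b : g.Site) => ((if y ∈ 𝔬.S' i then (1 : ℝ) else 0) * (θC * g.len y ^ (-2 : ℝ))) * (B1 * L₀ ^ |(1 : ℝ)| * B6.c1 d₁ δ₁ α₁) *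
        g.len y ^ (1 : ℝ) * Real.exp (-(ρ' * g.dist y b))) :=
    blockBd_comp_prefactor (R := R) (H := H) 𝔬.blk 𝔬.blk 𝔬.blk (fun y => (if y ∈ 𝔬.S' i then (1 : ℝ) else 0) * (θC * g.len y ^ (-2 : ℝ)))
      (fun y => mul_nonneg (hind i y) (mul_nonneg hθC (Real.rpow_nonneg (hlen0 y) _))) hF h261 htri hs.symm hs.dnn hs.lenpos hB1 hρ' hrate hδL
      (by rw [abs_one]; norm_num) (hCL2 i) (hOne i μ)
  have hPsum := blockBd_finsetSum (R := R) (H := H) (Finset.univ : Finset Dir) 𝔬.blk 𝔬.blk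
    (fun ν => 𝔩.P U i ν ∘ₗ (𝔡.Dd U ν ∘ₗ ((𝔬.Gsq U i * mulOp (𝔬.h i)) ∘ₗ 𝔡.Dsd U μ))) _ (fun ν _ => hPterm ν)
  have hall := blockBd_add_kernels (R := R) (H := H) 𝔬.blk 𝔬.blk hPsum hCterm
  rw [kopDir_Gsq_mulOp_comp_Dsd_eq]
  refine hall.mono fun y b => le_of_eq ?_
  have hy : 0 < g.len y := hs.lenpos y
  have hm2 : g.len y ^ (-2 : ℝ) * g.len y = g.len y ^ (-1 : ℝ) := by
    rw [show (-2 : ℝ) = -1 + -1 by norm_num, Real.rpow_add hy, Real.rpow_neg_one, mul_assoc, inv_mul_cancel₀ hy.ne', mul_one]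
  simp only [Finset.sum_const, Finset.card_univ, nsmul_eq_mul, abs_zero, abs_one, Real.rpow_zero, Real.rpow_one]
  linear_combination ((if y ∈ 𝔬.S' i then (1 : ℝ) else 0) * θC * (B1 * L₀ * B6.c1 d₁ δ₁ α₁) * Real.exp (-(ρ' * g.dist y b))) * hm2

end MixedFactor

end

end Literature.MathematicalPhysics.QuantumFieldTheory.Balaban1983to89.B9RWSums346MixedFactorFromLegs
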